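import Mathlib
import Summits.Ventures.PercRepro2.TypedCountInduction

/-!
# The typed count on multistars at the source, and the reduction «monotonicity off the source ⟹ T ≥ 0»
(blind cell PercRepro2, night-3 g25, 2026-08-29; `proofs/NIGHT3-CERT.md` §34.12)

Every inductive statement of the line dies at `n = 5` (§34.9–34.11) except one: **(MN)**
`T(H) ≥ T(H − e)` for every edge `e` NOT incident to the source `s` (cone-certified exhaustively for
all multigraphs with `n ≤ 5, m ≤ 7`, §34.12; every failure of edge-monotonicity found so far is at an
edge at `s`).  Deleting the non-source edges one by one then reduces
`T ≥ 0` to multistars at `s`, where it is a theorem: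

* **`typedCount_star_nonneg`** — for free edges `S` and contracted edges `C` all incident to `s`,
  `T(S, C) ≥ 0` (induction on `S` with the deletion identity: an edge `{s, u}`, `u ≠ v`, is never
  red-pivotal for `s ↔ v` in a star, so its pivotal sum vanishes; when only `s–v` edges are left
  every cluster is `K_s` or `K_s ∪ {v}`);
* **`typedCount_nonneg_of_mono_off_source`** — (MN) for all `(S, e)` implies `T(S, ∅) ≥ 0` for all `S`.

Own work; standard axioms.
-/

namespace Summit.Ventures.PercRepro2

namespace TypedDeletion

variable {V : Type*} {E : Type*}

/-- The edge set is a star at `s`: every edge of `S` is incident to `s`. -/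
def StarAt (ends : E → Sym2 V) (s : V) (S : Finset E) : Prop := ∀ e ∈ S, s ∈ ends e

section StarClusters

variable [DecidableEq E]

omit [DecidableEq E] in
/-- In a configuration whose open edges are all at `s`, the cluster of `s` consists of `s` and the
vertices joined to `s` by an open edge. -/
lemma cluster_subset_of_star {ends : E → Sym2 V} {ω : Config E} {s : V}
    (hstar : ∀ e, ω e = true → s ∈ ends e) :
    cluster ends ω s ⊆ {x | x = s ∨ ∃ e, ω e = true ∧ ends e = s(s, x)} := by
  refine cluster_subset_of_closed (Or.inl rfl) ?_
  intro e x y he hxy _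
  have hs : s ∈ ends e := hstar e he
  rw [hxy, Sym2.mem_iff] at hs
  rcases hs with hs | hs
  · exact Or.inr ⟨e, he, by rw [hxy, hs]⟩
  · exact Or.inl hs.symm

omit [DecidableEq E] in
/-- In a star configuration, `v ≠ s` lies in the cluster of `s` iff some open edge joins `s` and `v`. -/
lemma mem_cluster_star_iff {ends : E → Sym2 V} {ω : Config E} {s v : V} (hsv : v ≠ s)
    (hstar : ∀ e, ω e = true → s ∈ ends e) :
    v ∈ cluster ends ω s ↔ ∃ e, ω e = true ∧ ends e = s(s, v) := by
  constructor
  · intro h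
    rcases cluster_subset_of_star hstar h with h' | h'
    · exact absurd h' hsv
    · exact h'
  · rintro ⟨e, he, hends⟩
    exact mem_cluster_of_adj (mem_cluster_self _ _ _) (openGraph_adj.2 ⟨hsv.symm, e, he, hends⟩)

/-- Opening an edge `{s, u}` with `u ≠ v` never connects `v` to `s` in a star. -/
lemma pivotal_vanishes_star {ends : E → Sym2 V} {s v : V} (hsv : v ≠ s) {S : Finset E}
    (hS : StarAt ends s S) {e : E} (he : e ∈ S) (hev : ends e ≠ s(s, v)) {ω : Config E}
    (hω : OnS (S.erase e) ω) (hv : v ∈ cluster ends (Function.update ω e true) s) :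
    v ∈ cluster ends ω s := by
  have hstar' : ∀ e', Function.update ω e true e' = true → s ∈ ends e' := by
    intro e' he'
    by_cases h : e' = e
    · subst h; exact hS e' he
    · rw [Function.update_of_ne h] at he'
      exact hS e' (Finset.mem_of_mem_erase (hω e' he'))
  have hstar : ∀ e', ω e' = true → s ∈ ends e' := fun e' he' =>
    hS e' (Finset.mem_of_mem_erase (hω e' he'))
  obtain ⟨e', he', hends⟩ := (mem_cluster_star_iff hsv hstar').1 hv
  have hne : e' ≠ e := by
    rintro rfl
    exact hev hends
  rw [Function.update_of_ne hne] at he'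
  exact (mem_cluster_star_iff hsv hstar).2 ⟨e', he', hends⟩

end StarClusters

section Star

variable [Fintype E] [DecidableEq E] {R : Type*} [Field R] [LinearOrder R] [IsStrictOrderedRing R]

omit [LinearOrder R] [IsStrictOrderedRing R] in
/-- The pivotal sum at an edge `{s, u}`, `u ≠ v`, of a star vanishes. -/
lemma pivotalSum_star_eq_zero (ends : E → Sym2 V) {s v : V} (hsv : v ≠ s) (F G : Set V → R)
    {S : Finset E} (hS : StarAt ends s S) (C : Finset E) {e : E} (he : e ∈ S)
    (hev : ends e ≠ s(s, v)) : pivotalSum ends s v F G S C e = 0 := by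
  classical
  unfold pivotalSum
  apply Finset.sum_eq_zero
  intro ω _
  split_ifs with hω hp
  · exact absurd (pivotal_vanishes_star hsv hS he hev hω hp.1) hp.2
  · simp
  · rfl

/-- **The typed count is nonnegative on multistars at the source** (free and contracted edges all
incident to `s`). -/
theorem typedCount_star_nonneg (ends : E → Sym2 V) {s v : V} (hsv : v ≠ s) {F G : Set V → R}
    (hF : Monotone F) (hG : Monotone G) :
    ∀ (S : Finset E), StarAt ends s S → ∀ (C : Finset E), StarAt ends s C →
      0 ≤ typedCount ends s v F G S C := by
  intro S
  refine Finset.strongInductionOn S ?_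
  intro S ih hS C hC
  by_cases hex : ∃ e ∈ S, ends e ≠ s(s, v)
  · obtain ⟨e, he, hev⟩ := hex
    have hS' : StarAt ends s (S.erase e) := fun e' he' => hS e' (Finset.mem_of_mem_erase he')
    have hC' : StarAt ends s (insert e C) := by
      intro e' he'
      rcases Finset.mem_insert.1 he' with rfl | he'
      · exact hS e' he
      · exact hC e' he'
    rw [typedCount_deletion ends s v F G S C he, pivotalSum_star_eq_zero ends hsv F G hS C he hev,
      add_zero]
    have h1 := ih (S.erase e) (Finset.erase_ssubset he) hS' C hC
    have h2 := ih (S.erase e) (Finset.erase_ssubset he) hS' (insert e C) hC'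
    have h3 := boxSum_nonneg ends s v hF hG S C e
    linarith
  · -- only `s–v` edges are free: every term has comparable clusters
    have hall : ∀ e ∈ S, ends e = s(s, v) := by
      intro e he
      by_contra h
      exact hex ⟨e, he, h⟩
    by_cases hvK : v ∈ cclus ends C s
    · -- `v` already in the contracted cluster: the free edges change nothing, every term is `0`
      classical
      unfold typedCount
      apply Finset.sum_nonneg
      intro ω _
      split_ifs with hω
      · have hw : (0 : R) ≤ wt ends s v ω := by
          unfold wt; split_ifs <;> norm_num
        refine mul_nonneg hw (dlt_nonneg_of_comparable hF hG ?_)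
        -- both clusters equal `K_s`
        have key : ∀ ω' : Config E, OnS S ω' → cluster ends (withC C ω') s = cclus ends C s := by
          intro ω' hω'
          refine Set.Subset.antisymm ?_ (cluster_mono (withC_mono C (fun _ => Bool.false_le _)) s)
          refine cluster_subset_of_closed (mem_cluster_self _ _ _) ?_
          intro e' p q he' hpq hp
          simp only [withC_apply, Bool.or_eq_true, decide_eq_true_eq] at he'
          rcases he' with he' | he'
          · have hsv' := hall e' (hω' e' he')
            rw [hsv'] at hpq
            rcases Sym2.eq_iff.1 hpq with ⟨rfl, rfl⟩ | ⟨rfl, rfl⟩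
            · exact hvK
            · exact mem_cluster_self _ _ _
          · exact cclus_closed he' hpq hp
        rw [key ω hω, key (flipOn S ω) (onS_flipOn S ω)]
        exact Or.inl le_rfl
      · exact le_rfl
    · -- `v ∉ K_s`: every free edge is unsafe, the base case of `TypedCountInduction`
      refine typedCount_nonneg_of_no_safe ends s v hF hG S C hvK ?_
      intro e he
      have hev := hall e he
      rw [withC_insert]
      exact mem_cluster_of_adj (mem_cluster_self _ _ _)
        (openGraph_adj.2 ⟨hsv.symm, e, by simp [withC_apply], hev⟩)

/-- **The reduction**: if deleting an edge not at the source never increases the typed count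
(statement (MN)), then the typed count is nonnegative on every edge set. -/
theorem typedCount_nonneg_of_mono_off_source (ends : E → Sym2 V) {s v : V} (hsv : v ≠ s)
    {F G : Set V → R} (hF : Monotone F) (hG : Monotone G)
    (hmono : ∀ (S : Finset E) (e : E), e ∈ S → s ∉ ends e →
      typedCount ends s v F G (S.erase e) ∅ ≤ typedCount ends s v F G S ∅) :
    ∀ S : Finset E, 0 ≤ typedCount ends s v F G S ∅ := by
  intro S
  refine Finset.strongInductionOn S ?_
  intro S ih
  by_cases hex : ∃ e ∈ S, s ∉ ends e
  · obtain ⟨e, he, hes⟩ := hex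
    exact le_trans (ih (S.erase e) (Finset.erase_ssubset he)) (hmono S e he hes)
  · have hS : StarAt ends s S := by
      intro e he
      by_contra h
      exact hex ⟨e, he, h⟩
    exact typedCount_star_nonneg ends hsv hF hG S hS ∅ (fun e he => absurd he (Finset.notMem_empty e))

end Star

end TypedDeletion

end Summit.Ventures.PercRepro2
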